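import Mathlib.Combinatorics.SetFamily.FourFunctions
import Mathlib.Tactic
import HarnessLib
import HarnessLib.Audit.Tags
import Summits.CriticalPhenomena.PercolationContinuityZ3.Theorems.PercNearOneGluingNoHeavyLowerTailSahiCrossGoodSequence
import Summits.CriticalPhenomena.PercolationContinuityZ3.Theorems.PercNearOneGluingNoHeavyLowerTailSahiCrossFirstStep

/-!
# `CrossGoodSequence` as typed in gen 43 is FALSE (empty family) — the corrected conjecture and its bridge

Support file (seat `prim-masterthm-p1`, gen 44; `--supports stmt-CriticalPhenomena-4575`).  One corrected typed conjecture, three theorems; no `sorry`,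
standard axioms.  Memo `run/shared/lean/prim/prim-masterthm/FROM-prim-masterthm-p1-g44-MEMBER-FACE.md` §1.

WHAT WAS WRONG ([this work]).  `…SahiCrossGoodSequence.CrossGoodSequence` asks, for EVERY labelled crossing family `P ⊆ 2^F`, for a good compression
sequence of its signed family `Z = P ⊔ σP` ending in a configuration containing `∅`.  For `P = ∅` (allowed by the hypotheses, which are all vacuous)
`Z = ∅`, every projection of `∅` is `∅`, and no list is good: `not_goodSeq_empty`.  Hence `not_crossGoodSequence : ¬ CrossGoodSequence α` for every
type `α` (witness `F = ∅, P = ∅`), and the bridge `crossSignedColouredDaykin3_of_crossGoodSequence` (p646366), though correct, has a false hypothesis.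
The census evidence recorded for the conjecture (all 74 525 200 colour-canonical crossing 3-colour configurations of `2^6`, kit j311162/j311180) concerns
NONEMPTY families only and is unaffected.

THE REPAIR ([this work]).  `CrossGoodSequence'` = the same statement under `P.Nonempty`; `card_le_card_partDiffs_of_goodSeq` (a good sequence for the
signed family of a complement-free labelled `P` gives `#P ≤ #partDiffs F P κ` — the reusable core of the gen-43 bridge, no conjecture involved);
`crossSignedColouredDaykin3_of_crossGoodSequence'` (the inequality is trivial for `P = ∅`).  HONEST FRAMING: `CrossGoodSequence'` and
`CrossSignedColouredDaykin3` remain OPEN; see `…SahiTypeSetDaykinBlock` (gen 44) for the order-free weakening `CrossMemberFace` that also suffices. [this work]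
-/

namespace Summit.CriticalPhenomena.PercolationContinuityZ3.Theorems.SahiColouredDaykin

open Finset

variable {α : Type*} [DecidableEq α]

/-- No list is a good sequence from the EMPTY family: the final configuration would have to contain `∅`. [this work] -/
theorem not_goodSeq_empty : ∀ (ys : List α) (G : Finset α) (L : Finset α → Finset (ℕ × Bool)), ¬ GoodSeq G ∅ L ys
  | [], _, _, h => notMem_empty _ h
  | _ :: ys, G, L, h => by
      obtain ⟨_, _, hrest⟩ := h
      rw [image_empty] at hrest
      exact not_goodSeq_empty ys _ _ hrest

/-- **`CrossGoodSequence` (gen 43, as typed) is false**: take `F = ∅`, `P = ∅`. [this work] -/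
theorem not_crossGoodSequence : ¬ CrossGoodSequence α := by
  intro h
  obtain ⟨ys, hys⟩ := h ∅ ∅ (fun _ => 0) (by simp) (by simp) (by simp) (by simp)
  rw [image_empty, union_empty] at hys
  exact not_goodSeq_empty ys ∅ _ hys

/-- **CONJECTURE T_cross, corrected (typed): every NONEMPTY crossing labelled configuration admits a good compression sequence.**
Evidence: `…SahiCrossGoodSequence` file header (exhaustive `2^5`, `2^6`; sampled `2^7`–`2^9`). [this work] [status: open] -/
@[conjecture] def CrossGoodSequence' (α : Type*) [DecidableEq α] : Prop :=
  ∀ (F : Finset α) (P : Finset (Finset α)) (κ : Finset α → ℕ), P.Nonempty →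
    (∀ S ∈ P, S ⊆ F) → (∀ S ∈ P, κ S < 3) →
    (∀ S ∈ P, ∀ T ∈ P, κ S ≠ κ T → ¬ S ⊆ T) →
    (∀ S ∈ P, ∀ T ∈ P, (S ∩ T).Nonempty ∧ S ∪ T ≠ F) →
    ∃ ys : List α, GoodSeq F (P ∪ P.image (fun S => F \ S)) (signedTypes F P κ) ys

/-- **A good sequence proves the partition-difference inequality** for a complement-free labelled family (no crossing needed here: the
signed family is a type-set configuration with `#Z = 2·#P` whose compatible meets are partition differences). [this work] -/
theorem card_le_card_partDiffs_of_goodSeq {F : Finset α} {P : Finset (Finset α)} {κ : Finset α → ℕ}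
    (hPF : ∀ S ∈ P, S ⊆ F) (hcf : ∀ S ∈ P, F \ S ∉ P) {ys : List α}
    (hys : GoodSeq F (P ∪ P.image (fun S => F \ S)) (signedTypes F P κ) ys) : #P ≤ #(partDiffs F P κ) := by
  obtain ⟨hZG, hcc, hne, hflip, hcardZ⟩ := signed_config (κ := κ) hPF hcf
  have key := ineq_of_goodSeq ys F _ _ hZG hcc hne hflip hys
  have hsub := card_le_card (typeMeets_signed_subset_partDiffs (κ := κ) hPF hcf)
  have : 2 * #P ≤ 2 * #(partDiffs F P κ) :=
    calc 2 * #P = #(P ∪ P.image (fun S => F \ S)) := hcardZ.symm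
      _ ≤ #(P ∪ P.image (fun S => F \ S)) +
            #((P ∪ P.image (fun S => F \ S)).filter fun z =>
              lcompat (signedTypes F P κ z) (signedTypes F P κ z) = true) := Nat.le_add_right _ _
      _ ≤ 2 * #(typeMeets (P ∪ P.image (fun S => F \ S)) (signedTypes F P κ)) := key
      _ ≤ 2 * #(partDiffs F P κ) := Nat.mul_le_mul_left 2 hsub
  omega

/-- `CrossGoodSequence' ⟹` the partition-difference inequality for every crossing labelled configuration (labels `< 3`). [this work] -/
theorem card_le_card_partDiffs_of_crossGoodSequence' (h : CrossGoodSequence' α) (F : Finset α) (P : Finset (Finset α))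
    (κ : Finset α → ℕ) (hPF : ∀ S ∈ P, S ⊆ F) (hκ : ∀ S ∈ P, κ S < 3) (hinc : ∀ S ∈ P, ∀ T ∈ P, κ S ≠ κ T → ¬ S ⊆ T)
    (hcross : ∀ S ∈ P, ∀ T ∈ P, (S ∩ T).Nonempty ∧ S ∪ T ≠ F) : #P ≤ #(partDiffs F P κ) := by
  rcases P.eq_empty_or_nonempty with rfl | hP
  · simp
  have hcf : ∀ S ∈ P, F \ S ∉ P := by
    intro S hS hS'
    have hne := (hcross S hS (F \ S) hS').1
    rw [inter_sdiff_self] at hne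
    exact Finset.not_nonempty_empty hne
  obtain ⟨ys, hys⟩ := h F P κ hP hPF hκ hinc hcross
  exact card_le_card_partDiffs_of_goodSeq hPF hcf hys

/-- **THE CORRECTED BRIDGE: `CrossGoodSequence' ⟹ CrossSignedColouredDaykin3`.** [this work] -/
theorem crossSignedColouredDaykin3_of_crossGoodSequence' (h : CrossGoodSequence' α) : CrossSignedColouredDaykin3 α := by
  intro F P c hPF hinc hcross
  have hinc' : ∀ S ∈ P, ∀ T ∈ P, ((c S : ℕ)) ≠ (c T : ℕ) → ¬ S ⊆ T :=
    fun S hS T hT hne => hinc S hS T hT (fun h => hne (by rw [h]))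
  have hκ : ∀ S ∈ P, ((c S : ℕ)) < 3 := fun S _ => (c S).isLt
  have := card_le_card_partDiffs_of_crossGoodSequence' h F P (fun S => ((c S : ℕ))) hPF hκ hinc' hcross
  rw [partDiffs_val_eq_admDiffs] at this
  exact this.trans (card_admDiffs_le_card_compatJoins hPF)

end Summit.CriticalPhenomena.PercolationContinuityZ3.Theorems.SahiColouredDaykin
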